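import Summits.BirchSwinnertonDyer.BirchSwinnertonDyer.Theorems.GoldfeldAllTwistsTwoConverseTwinQuarterTraceIndexB4ThreeModEightPOneSharp
import Summits.BirchSwinnertonDyer.BirchSwinnertonDyer.Theorems.GoldfeldAllTwistsTwoConverseTwinQuarterTraceIndexB4SevenModEightModFourUnion
import HarnessLib

set_option linter.dupNamespace false -- namespace `…BirchSwinnertonDyer.BirchSwinnertonDyer…` is the cell's (D-0017 nested layout)
set_option autoImplicit false

/-!
# `BSD(W, 2)` on the `(†) ∪ χ_Z`-decidable locus of the two-prime family `49a1^{(−2qp)}`, `(p/q) = −1`: §1 the β-UNION at `p ≡ 1 (mod 4)`,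
# `q ≡ 3 (mod 4)` (cells C5 ∪ C6 ∪ C7 ∪ C8); §2 the capstone «`q ≡ 7 (mod 8)` OR type β» — from print + Kolyvagin, NO Cassels–Tate

Cell `bsd-goldfeld`, seat `bsd-goldfeld-s1p-c3x` (gen 14); planner RULING (ccclxxix) ORDER «OBJECT U′» (one file). `--supports stmt-BirchSwinnertonDyer-19140`
as a HELPER. Theses-free; theorems only (a pure case split); no definition, no `sorry`, no new fact.

§1 `bsdp_two_negTwoPrimesTwist_beta_modFour_of_print_sharp`: by `omega` on `p mod 8` and `q mod 8` onto B⁗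
`bsdp_two_negTwoPrimesTwist_beta_of_print` (`p ≡ 5 (8)`) ∣ `bsdp_two_negTwoPrimesTwist_betaPOne_of_print_sharp` (`q ≡ 7 (8)`, `p ≡ 1 (8)`) ∣
`bsdp_two_negTwoPrimesTwist_betaPOne_threeModEight_of_print_sharp` (`q ≡ 3 (8)`, `p ≡ 1 (8)`); include = SIXTEEN named inputs
`hCST hGZ h12 h44 h13 h14 hS31 hnew hM hBT hBF hGZK hEta hEta₀ hD hKo` = the union of the three branches' lists by name, nothing else.
§2 `bsdp_two_negTwoPrimesTwist_sevenModEightOrBeta_modFour_of_print` (`hcell : q % 8 = 7 ∨ ∃ x : ZMod p, x^4 = −7`): by cases onto U2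
`bsdp_two_negTwoPrimesTwist_sevenModEight_modFour_of_print` ∣ §1; include = EIGHTEEN named inputs = U2's list letter-identical (`… hBCST hpar hKo`), nothing else; NO `hCT`.
HONEST FRAMING: BSD(W,2) on twist-density-ZERO two-parameter cells modulo named print; FRONTIER-grade, never distance-to-summit; items 19140 / 19350 / 20044
NOT closed; BSD is not proved by any of this.

References: [Miller2011LMS] Def. 1.1; [GrossZagier1986] Thm I.(6.3), V.§2; [CoatesLiTianZhai2015] Thm 1.2–1.4, 4.4; [LiMa2008] Thm 0.4;
[BurungaleCastellaSkinnerTian2022] Thm A, Rem. D; [SilvermanAEC2009] Thm X.4.14.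
-/

noncomputable section

open scoped Classical

open WeierstrassCurve NumberField Literature.NumberTheory Literature.NumberTheory.EllipticCurves
  Literature.NumberTheory.EllipticCurves.ModularForms Literature.NumberTheory.EllipticCurves.CaiShuTian2014
  Literature.NumberTheory.EllipticCurves.CoatesLiTianZhai2015

namespace Summit.BirchSwinnertonDyer.BirchSwinnertonDyer.Theorems.GoldfeldGoodTwists

/-! ## §1 The β-union at `p ≡ 1 (mod 4)` (cells C5 ∪ C6 ∪ C7 ∪ C8), formula axis -/
section BetaUnionFormula

variable (hCST : thm11_ringClassChar)
  (hGZ : ∀ (N : ℕ) [NeZero N] (W : WeierstrassCurve ℚ) (K : Type) [Field K] [NumberField K], gross_zagier N W K)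
  (h12 : thm12_fullBSD_twist) (h44 : thm44_ord_two_LAlg) (h13 : thm13_ord_two_LAlg) (h14 : thm14_rankOne_twist)
  (hS31 : bsdTriple_of_rank_le_one_of_conductor_lt) (hnew : exists_isNewformOf) (hM : OptimalCurveManinCertificate cm7)
  (hBT : burungaleTian_analyticRank_eq_zero_of_selmerCorank_eq_zero_of_hasCM) (hBF : bsdTriple_of_hasCM_of_L_one_ne_zero)
  (hGZK : rank_eq_analyticRank_of_analyticRank_le_one) (hEta : x049_heegner_norm_x_sub_two_not_mem)
  (hEta₀ : x049_x_sub_two_eq_etaQuotient) (hD : deuring_etaQuotient49_heegner_generates_conjPrime)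
  (hKo : ∀ (N : ℕ) [NeZero N] (W : WeierstrassCurve ℚ) (K : Type) [Field K] [NumberField K], kolyvagin N W K)
include hCST hGZ h12 h44 h13 h14 hS31 hnew hM hBT hBF hGZK hEta hEta₀ hD hKo

/-- **`BSD(W, 2)` ON THE β CELLS AT `p ≡ 1 (mod 4)`, FROM PRINT + KOLYVAGIN — no residue of `p` or `q` mod `8`, NO Cassels–Tate.** `q > 3` prime, `q ≡ 3 (mod 4)`,
`(q/7) = −1`; `p ≡ 1 (mod 4)` prime, `(−7/p) = +1`, `−7` a fourth power mod `p` (type β); `(p/q) = −1`; `W/ℚ` globally minimal elliptic with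
`C • W = X₀(49)^{(−2qp)}` for some `C`: **`BSD(W, 2)`** — by cases `p ≡ 5 (8)` (B⁗ `bsdp_two_negTwoPrimesTwist_beta_of_print`) ∣ `p ≡ 1 (8)`, `q ≡ 7 (8)` (the C7 sharp closer
`bsdp_two_negTwoPrimesTwist_betaPOne_of_print_sharp`) ∣ `p ≡ 1 (8)`, `q ≡ 3 (8)` (`bsdp_two_negTwoPrimesTwist_betaPOne_threeModEight_of_print_sharp`). SIXTEEN named
inputs (the union of the branches' by name), nothing else. Twist-density ZERO; not a closer of any item; BSD is not proved by any of this.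
[cite: Miller2011LMS, Def. 1.1] [cite: GrossZagier1986, Thm. I.(6.3) and V.§2] [cite: CoatesLiTianZhai2015, Thm. 1.2 (p. 359), 1.3, 1.4 and 4.4] [cite: LiMa2008, Thm. 0.4]
[cite: SilvermanAEC2009, Thm. X.4.14] -/
theorem bsdp_two_negTwoPrimesTwist_beta_modFour_of_print_sharp
    {q p : ℕ} (hq : q.Prime) (h3 : 3 < q) (hq4 : q % 4 = 3) (hq7 : jacobiSym q 7 = -1)
    [Fact p.Prime] (hp4 : p % 4 = 1) (hp7 : legendreSym p (-7) = 1) (hβ : ∃ x : ZMod p, x ^ 4 = -7) (hpq : jacobiSym (p : ℤ) q = -1)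
    (W : WeierstrassCurve ℚ) [W.IsElliptic] [W.IsGloballyMinimal]
    (hC : ∃ C : VariableChange ℚ, C • W = cm7.quadraticTwist (-(2 * (q : ℚ) * p))) : BSDp W 2 := by
  obtain ⟨C, hC⟩ := hC
  haveI := Fact.mk hq
  obtain hp8 | hp8 : p % 8 = 1 ∨ p % 8 = 5 := by omega
  · obtain hq8 | hq8 : q % 8 = 3 ∨ q % 8 = 7 := by omega
    · exact bsdp_two_negTwoPrimesTwist_betaPOne_threeModEight_of_print_sharp hCST hGZ h12 h44 h13 h14 hS31 hnew hM hBF hGZK hEta hEta₀ hD hKo hq h3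
        hq8 hq7 hp8 hp7 hβ hpq W C hC
    · exact bsdp_two_negTwoPrimesTwist_betaPOne_of_print_sharp hCST hGZ h12 h44 h13 h14 hS31 hnew hM hBF hGZK hEta hEta₀ hD hKo hq hq8 hq7 hp8
        hp7 hβ hpq W C hC
  · exact bsdp_two_negTwoPrimesTwist_beta_of_print hCST hGZ h12 h44 h13 h14 hS31 hnew hM hBT hBF hGZK hEta hEta₀ hD hKo hq h3 hq4 hq7
      hp8 hp7 hβ hpq W C hC

end BetaUnionFormula

/-! ## §2 The capstone on `{q ≡ 7 (mod 8)} ∪ {type β}`, formula axis -/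
section CapstoneFormula

variable (hCST : thm11_ringClassChar)
  (hGZ : ∀ (N : ℕ) [NeZero N] (W : WeierstrassCurve ℚ) (K : Type) [Field K] [NumberField K], gross_zagier N W K)
  (h12 : thm12_fullBSD_twist) (h44 : thm44_ord_two_LAlg) (h13 : thm13_ord_two_LAlg) (h14 : thm14_rankOne_twist)
  (hS31 : bsdTriple_of_rank_le_one_of_conductor_lt) (hnew : exists_isNewformOf) (hM : OptimalCurveManinCertificate cm7)
  (hBT : burungaleTian_analyticRank_eq_zero_of_selmerCorank_eq_zero_of_hasCM) (hBF : bsdTriple_of_hasCM_of_L_one_ne_zero)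
  (hGZK : rank_eq_analyticRank_of_analyticRank_le_one) (hEta : x049_heegner_norm_x_sub_two_not_mem)
  (hEta₀ : x049_x_sub_two_eq_etaQuotient) (hD : deuring_etaQuotient49_heegner_generates_conjPrime)
  (hBCST : BurungaleCastellaSkinnerTian2022.thmA_analyticRank_eq_one_of_selmerCorank_eq_one)
  (hpar : ∀ (V : WeierstrassCurve ℚ) [V.IsElliptic], p_parity V 2)
  (hKo : ∀ (N : ℕ) [NeZero N] (W : WeierstrassCurve ℚ) (K : Type) [Field K] [NumberField K], kolyvagin N W K)
include hCST hGZ h12 h44 h13 h14 hS31 hnew hM hBT hBF hGZK hEta hEta₀ hD hBCST hpar hKo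

/-- **`BSD(W, 2)` ON THE `(†) ∪ χ_Z`-DECIDABLE LOCUS, FROM PRINT + KOLYVAGIN.** `q > 3` prime, `q ≡ 3 (mod 4)`, `(q/7) = −1`; `p ≡ 1 (mod 4)` prime, `(−7/p) = +1`;
`(p/q) = −1`; `q ≡ 7 (mod 8)` OR `−7` is a fourth power mod `p`; `W/ℚ` globally minimal elliptic with `C • W = X₀(49)^{(−2qp)}` for some `C`: **`BSD(W, 2)`** — by cases
onto U2 `bsdp_two_negTwoPrimesTwist_sevenModEight_modFour_of_print` (`q ≡ 7 (8)`, every type) ∣ §1 `bsdp_two_negTwoPrimesTwist_beta_modFour_of_print_sharp` (type β, both `q`-cells).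
EIGHTEEN named inputs (U2's), nothing else. With R2's rank-axis capstone: `BSD(W,2) ∧ r_an(W) = rank W(ℚ) = 1 ∧ Ш(W)` finite for EVERY `W ≅ 49a1^{(−2qp)}` on this locus
— i.e. on every `(p/q) = −1` cell of the family except the genuinely mixed α-cells C1/C2 (`q ≡ 3 (8)`, type α, where rank `3` occurs). A density-zero two-parameter
family modulo named print; FRONTIER-grade; items unchanged; BSD is not proved by any of this. [cite: Miller2011LMS, Def. 1.1] [cite: GrossZagier1986, Thm. I.(6.3) and V.§2]
[cite: CoatesLiTianZhai2015, Thm. 1.2 (p. 359), 1.3, 1.4 and 4.4] [cite: LiMa2008, Thm. 0.4] [cite: BurungaleCastellaSkinnerTian2022, Thm. A (p. 326) and Rem. D (p. 327)]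
[cite: SilvermanAEC2009, Thm. X.4.14] -/
theorem bsdp_two_negTwoPrimesTwist_sevenModEightOrBeta_modFour_of_print
    {q p : ℕ} (hq : q.Prime) (h3 : 3 < q) (hq4 : q % 4 = 3) (hq7 : jacobiSym q 7 = -1)
    [Fact p.Prime] (hp4 : p % 4 = 1) (hp7 : legendreSym p (-7) = 1) (hpq : jacobiSym (p : ℤ) q = -1)
    (hcell : q % 8 = 7 ∨ ∃ x : ZMod p, x ^ 4 = -7)
    (W : WeierstrassCurve ℚ) [W.IsElliptic] [W.IsGloballyMinimal]
    (hC : ∃ C : VariableChange ℚ, C • W = cm7.quadraticTwist (-(2 * (q : ℚ) * p))) : BSDp W 2 := by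
  rcases hcell with hq8 | hβ
  · exact bsdp_two_negTwoPrimesTwist_sevenModEight_modFour_of_print hCST hGZ h12 h44 h13 h14 hS31 hnew hM hBT hBF hGZK hEta hEta₀ hD hBCST hpar hKo
      hq h3 hq8 hq7 hp4 hp7 hpq W hC
  · exact bsdp_two_negTwoPrimesTwist_beta_modFour_of_print_sharp hCST hGZ h12 h44 h13 h14 hS31 hnew hM hBT hBF hGZK hEta hEta₀ hD hKo hq h3 hq4 hq7 hp4
      hp7 hβ hpq W hC

end CapstoneFormula

end Summit.BirchSwinnertonDyer.BirchSwinnertonDyer.Theorems.GoldfeldGoodTwists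

end
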